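import Summits.NavierStokesRegularity.NavierStokesRegularity.Theorems.SqueezeCycleSingularZoomSingular
import HarnessLib

/-!
# Zoom-ins about a translated centre and persistence with a limsup hypothesis
(helper file for crux `HubbleDynamo.FarFieldSlaving`, stmt-NavierStokesRegularity-1935; theorems only)

Let `(v, π)` be a suitable weak solution of the unit-viscosity system in the unit parabolic ball
`Q(0, 1)` with weak gradient `Gv` and Type-I quantity `I₀ = 𝐈(Q(0, 1/2); v, π, Gv)`. For the zooms
`v_c = c • stPull (c²) c 0 x₁ v` about a SPATIALLY TRANSLATED centre `(0, x₁)` (pressure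
`c² • stPull (c²) c 0 x₁ π`, gradient `c² • stPull (c²) c 0 x₁ Gv`), under the hypothesis that the
image ball `Q((0, x₁), c)` lies in `Q(0, 1/2)` (resp. `Q(0, 1)`), this file proves the analogues of
the blow-down lemmas of `SqueezeCycleSingularZoomLocal` (which treat the centre `(0, 0)`):

* `zoomInAt_isSuitableWeakSolutionOn`, `zoomInAt_hasWeakSpatialGradientOn`, `abScaledSum_zoomInAt_le`
  (`(A + C + D + E)(Q(z, r); v_c, π_c, ∇v_c) ≤ I₀` if `Q(Φ_c z, c r) ⊆ Q(0, 1/2)`),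
  `isSuitableWeakSolutionInBall_zoomInAt` (hypotheses of A–B Lemma 2.2 in `Q(0, 1)`, mean-free
  pressure), `eLpNorm_zoomInAt_velocity_le` / `eLpNorm_zoomInAt_pressure_le` (`≤ I₀^{1/3}`, `I₀^{2/3}`);
* `unbounded_at_origin_of_tendsto_top` — persistence of the singularity in the limit, with the
  hypothesis that the `L^∞(Q(0, R'))` norms of the approximating velocities TEND to `∞`.
-/

noncomputable section

set_option linter.dupNamespace false

open MeasureTheory Set Function Filter TopologicalSpace Metric
open scoped Topology NNReal ENNReal InnerProductSpace RealInnerProductSpace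

namespace Summit.NavierStokesRegularity.NavierStokesRegularity.Theorems

open Literature.Analysis Literature.Analysis.FluidPDE

/-! ### Zooming in about a translated centre `(0, x₁)` -/

section ZoomInAt

variable {v : ℝ → EuclideanSpace ℝ (Fin 3) → EuclideanSpace ℝ (Fin 3)}
  {π : ℝ → EuclideanSpace ℝ (Fin 3) → ℝ}
  {Gv : ℝ → EuclideanSpace ℝ (Fin 3) → EuclideanSpace ℝ (Fin 3) →L[ℝ] EuclideanSpace ℝ (Fin 3)}
  {c : ℝ} {x₁ : EuclideanSpace ℝ (Fin 3)}

/-- The zoom about `(0, x₁)` maps the origin to `(0, x₁)`. [folklore] -/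
theorem stAffine_sq_zero_at (c : ℝ) (x₁ : EuclideanSpace ℝ (Fin 3)) :
    stAffine (c ^ 2) c 0 x₁ (0 : ℝ × EuclideanSpace ℝ (Fin 3)) = ((0 : ℝ), x₁) := by
  simp [stAffine]

/-- If the image ball `Q((0, x₁), c)` lies in `Q(0, 1)`, the unit parabolic ball lies in its own
zoomed preimage. [folklore] -/
theorem parabolicCylinderOpens_one_le_stPreimage_at (hc : 0 < c)
    (hsub1 : parabolicCylinder c (((0 : ℝ), x₁) : ℝ × EuclideanSpace ℝ (Fin 3)) ⊆
      parabolicCylinder 1 (0 : ℝ × EuclideanSpace ℝ (Fin 3))) :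
    parabolicCylinderOpens 1 (0 : ℝ × EuclideanSpace ℝ (Fin 3)) ≤
      stPreimage (c ^ 2) c 0 x₁ (parabolicCylinderOpens 1 (0 : ℝ × EuclideanSpace ℝ (Fin 3))) := by
  intro z hz
  show stAffine (c ^ 2) c 0 x₁ z ∈ (parabolicCylinderOpens 1 (0 : ℝ × EuclideanSpace ℝ (Fin 3)) :
    Set (ℝ × EuclideanSpace ℝ (Fin 3)))
  rw [coe_parabolicCylinderOpens]
  refine hsub1 ?_
  have key := LocalTypeIScaling.stAffine_preimage_parabolicCylinder hc 0 x₁ 1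
    (0 : ℝ × EuclideanSpace ℝ (Fin 3))
  rw [mul_one, stAffine_sq_zero_at] at key
  rw [← mem_preimage, key]
  exact hz

/-- **The zoomed pair about `(0, x₁)` is a suitable weak solution in the unit parabolic ball**
(covariance `IsSuitableWeakSolutionOn.stRescale` with `α = γ = c`, `β = c²`, unit viscosity,
zero force, restricted from `Φ_c⁻¹ Q(0, 1)` to `Q(0, 1)`). [folklore] -/
theorem zoomInAt_isSuitableWeakSolutionOn
    (hsw : IsSuitableWeakSolutionOn (parabolicCylinderOpens 1 (0 : ℝ × EuclideanSpace ℝ (Fin 3)))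
      1 0 v π) (hc : 0 < c)
    (hsub1 : parabolicCylinder c (((0 : ℝ), x₁) : ℝ × EuclideanSpace ℝ (Fin 3)) ⊆
      parabolicCylinder 1 (0 : ℝ × EuclideanSpace ℝ (Fin 3))) :
    IsSuitableWeakSolutionOn (parabolicCylinderOpens 1 (0 : ℝ × EuclideanSpace ℝ (Fin 3))) 1 0
      (c • stPull (c ^ 2) c 0 x₁ v) (c ^ 2 • stPull (c ^ 2) c 0 x₁ π) := by
  have h := hsw.stRescale hc hc (sq c) 0 x₁
  have e1 : c * 1 / c = 1 := by field_simp
  have e2 : ((c ^ 2 * c) • stPull (c ^ 2) c 0 x₁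
      (0 : ℝ → EuclideanSpace ℝ (Fin 3) → EuclideanSpace ℝ (Fin 3))) = 0 := by
    funext t x; simp [stPull]
  rw [e1, e2] at h
  exact h.of_le (parabolicCylinderOpens_one_le_stPreimage_at hc hsub1)

/-- The zoomed weak spatial gradient `∇v_c = c² (∇v) ∘ Φ_c` on the unit parabolic ball (centre
`(0, x₁)`). [folklore] -/
theorem zoomInAt_hasWeakSpatialGradientOn
    (hwg : HasWeakSpatialGradientOn (parabolicCylinderOpens 1 (0 : ℝ × EuclideanSpace ℝ (Fin 3))) v Gv)
    (hc : 0 < c)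
    (hsub1 : parabolicCylinder c (((0 : ℝ), x₁) : ℝ × EuclideanSpace ℝ (Fin 3)) ⊆
      parabolicCylinder 1 (0 : ℝ × EuclideanSpace ℝ (Fin 3))) :
    HasWeakSpatialGradientOn (parabolicCylinderOpens 1 (0 : ℝ × EuclideanSpace ℝ (Fin 3)))
      (c • stPull (c ^ 2) c 0 x₁ v) (c ^ 2 • stPull (c ^ 2) c 0 x₁ Gv) := by
  have h := hwg.stRescale c (by positivity : 0 < c ^ 2) hc 0 x₁
  rw [← sq] at h
  exact h.mono (parabolicCylinderOpens_one_le_stPreimage_at hc hsub1)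

/-- **The Type-I bound is inherited by the triple zoomed about `(0, x₁)`**: for every ball
`Q(z, r)` whose image `Q(Φ_c z, c r)` lies in `Q(0, 1/2)`,
`(A + C + D + E)(Q(z, r); v_c, π_c, ∇v_c) ≤ 𝐈(Q(0, 1/2); v)` (scale invariance,
`abScaledSum_nsZoom`; A–B §3, (3.3)). [cite: AlbrittonBarker2019, §3] -/
theorem abScaledSum_zoomInAt_le (hc : 0 < c) {r : ℝ} (hr : 0 < r)
    {z : ℝ × EuclideanSpace ℝ (Fin 3)}
    (hz : parabolicCylinder (c * r) (stAffine (c ^ 2) c 0 x₁ z) ⊆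
      parabolicCylinder (1 / 2) (0 : ℝ × EuclideanSpace ℝ (Fin 3))) :
    abScaledSum r z (c • stPull (c ^ 2) c 0 x₁ v) (c ^ 2 • stPull (c ^ 2) c 0 x₁ π)
        (c ^ 2 • stPull (c ^ 2) c 0 x₁ Gv) ≤
      typeIBound (parabolicCylinder (1 / 2) (0 : ℝ × EuclideanSpace ℝ (Fin 3))) v π Gv := by
  rw [abScaledSum_nsZoom hc hr]
  exact abScaledSum_le_typeIBound (mul_pos hc hr) hz

/-- The image of the unit ball under the zoom about `(0, x₁)` is `Q((0, x₁), c)`; if the latter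
lies in `Q(0, 1/2)` then so does the former. [folklore] -/
theorem parabolicCylinder_zoomInAt_one_subset (c : ℝ) (x₁ : EuclideanSpace ℝ (Fin 3))
    (hsub : parabolicCylinder c (((0 : ℝ), x₁) : ℝ × EuclideanSpace ℝ (Fin 3)) ⊆
      parabolicCylinder (1 / 2) (0 : ℝ × EuclideanSpace ℝ (Fin 3))) :
    parabolicCylinder (c * 1) (stAffine (c ^ 2) c 0 x₁ (0 : ℝ × EuclideanSpace ℝ (Fin 3))) ⊆
      parabolicCylinder (1 / 2) (0 : ℝ × EuclideanSpace ℝ (Fin 3)) := by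
  rw [mul_one, stAffine_sq_zero_at]
  exact hsub

/-- `Q((0, x₁), c) ⊆ Q(0, 1/2)` implies `Q((0, x₁), c) ⊆ Q(0, 1)`. [folklore] -/
theorem parabolicCylinder_at_subset_one
    (hsub : parabolicCylinder c (((0 : ℝ), x₁) : ℝ × EuclideanSpace ℝ (Fin 3)) ⊆
      parabolicCylinder (1 / 2) (0 : ℝ × EuclideanSpace ℝ (Fin 3))) :
    parabolicCylinder c (((0 : ℝ), x₁) : ℝ × EuclideanSpace ℝ (Fin 3)) ⊆
      parabolicCylinder 1 (0 : ℝ × EuclideanSpace ℝ (Fin 3)) :=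
  hsub.trans (SuitableCompactness.parabolicCylinder_zero_mono (by norm_num) (by norm_num))

/-- The pressure zoomed about `(0, x₁)` lies in `L^{3/2}(Q(0, 1))`:
`Q(0, 1) = Φ_c⁻¹(Q((0, x₁), c))` and
`∫_{Q(0,1)} |π_c|^{3/2} = c⁻² ∫_{Q((0,x₁),c)} |π|^{3/2} ≤ c⁻² ∫_{Q(0,1)} |π|^{3/2} < ∞`. [folklore] -/
theorem memLp_zoomInAt_pressure
    (hsw : IsSuitableWeakSolutionOn (parabolicCylinderOpens 1 (0 : ℝ × EuclideanSpace ℝ (Fin 3)))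
      1 0 v π)
    (hπ : MemLp (uncurry π) (3 / 2)
      (volume.restrict (parabolicCylinder 1 (0 : ℝ × EuclideanSpace ℝ (Fin 3)))))
    (hc : 0 < c)
    (hsub1 : parabolicCylinder c (((0 : ℝ), x₁) : ℝ × EuclideanSpace ℝ (Fin 3)) ⊆
      parabolicCylinder 1 (0 : ℝ × EuclideanSpace ℝ (Fin 3))) :
    MemLp (uncurry (c ^ 2 • stPull (c ^ 2) c 0 x₁ π)) (3 / 2)
      (volume.restrict (parabolicCylinder 1 (0 : ℝ × EuclideanSpace ℝ (Fin 3)))) := by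
  obtain ⟨h32, h32', h32r⟩ := threeHalves_facts
  have hsuit := zoomInAt_isSuitableWeakSolutionOn hsw hc hsub1
  refine ⟨hsuit.distributional.2.2.1.aestronglyMeasurable, ?_⟩
  rw [eLpNorm_eq_lintegral_rpow_enorm_toReal (zero_lt_one.trans_le h32).ne' h32', h32r]
  refine ENNReal.rpow_lt_top_of_nonneg (by positivity) (ne_of_lt ?_)
  have hQ : parabolicCylinder 1 (0 : ℝ × EuclideanSpace ℝ (Fin 3)) =
      stAffine (c ^ 2) c 0 x₁ ⁻¹'
        parabolicCylinder c (((0 : ℝ), x₁) : ℝ × EuclideanSpace ℝ (Fin 3)) := by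
    have key := LocalTypeIScaling.stAffine_preimage_parabolicCylinder hc 0 x₁ 1
      (0 : ℝ × EuclideanSpace ℝ (Fin 3))
    rw [mul_one, stAffine_sq_zero_at] at key
    exact key.symm
  rw [hQ]
  show ∫⁻ z in stAffine (c ^ 2) c 0 x₁ ⁻¹'
      parabolicCylinder c (((0 : ℝ), x₁) : ℝ × EuclideanSpace ℝ (Fin 3)),
      ‖(c ^ 2 • stPull (c ^ 2) c 0 x₁ π) z.1 z.2‖ₑ ^ (3 / 2 : ℝ) < ⊤
  rw [setLIntegral_enorm_rpow_stRescale (by positivity : 0 < c ^ 2) hc 0 x₁ (c ^ 2) π _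
    (by norm_num)]
  refine ENNReal.mul_lt_top (ENNReal.mul_lt_top
    (ENNReal.rpow_lt_top_of_nonneg (by norm_num) enorm_ne_top) ENNReal.ofReal_lt_top) ?_
  have hfin := hπ.eLpNorm_lt_top
  rw [eLpNorm_eq_lintegral_rpow_enorm_toReal (zero_lt_one.trans_le h32).ne' h32', h32r] at hfin
  refine lt_of_le_of_lt (lintegral_mono_set hsub1) ?_
  exact (ENNReal.rpow_lt_top_iff_of_pos (by norm_num)).1 hfin

/-- The time-dependent mean over `B(0, 1)` of the pressure zoomed about `(0, x₁)` is in
`L^{3/2}(Q(0, 1))`. [folklore] -/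
theorem memLp_zoomInAt_pressure_mean
    (hsw : IsSuitableWeakSolutionOn (parabolicCylinderOpens 1 (0 : ℝ × EuclideanSpace ℝ (Fin 3)))
      1 0 v π)
    (hπ : MemLp (uncurry π) (3 / 2)
      (volume.restrict (parabolicCylinder 1 (0 : ℝ × EuclideanSpace ℝ (Fin 3)))))
    (hc : 0 < c)
    (hsub1 : parabolicCylinder c (((0 : ℝ), x₁) : ℝ × EuclideanSpace ℝ (Fin 3)) ⊆
      parabolicCylinder 1 (0 : ℝ × EuclideanSpace ℝ (Fin 3))) :
    MemLp (fun w : ℝ × EuclideanSpace ℝ (Fin 3) =>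
        ⨍ y in ball (0 : EuclideanSpace ℝ (Fin 3)) 1, (c ^ 2 • stPull (c ^ 2) c 0 x₁ π) w.1 y)
      (3 / 2) (volume.restrict (parabolicCylinder 1 (0 : ℝ × EuclideanSpace ℝ (Fin 3)))) := by
  obtain ⟨h32, h32', -⟩ := threeHalves_facts
  have hpm := memLp_zoomInAt_pressure hsw hπ hc hsub1
  have hQ1 : parabolicCylinder 1 (0 : ℝ × EuclideanSpace ℝ (Fin 3)) =
      Ioo (-1 : ℝ) 0 ×ˢ ball (0 : EuclideanSpace ℝ (Fin 3)) 1 := by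
    simp [parabolicCylinder]
  rw [hQ1] at hpm ⊢
  exact memLp_setAverage_slice (measure_ball_pos volume _ one_pos).ne' measure_ball_lt_top.ne
    h32 h32' hpm

/-- **The triple zoomed about `(0, x₁)` satisfies the hypotheses of A–B Lemma 2.2 on `Q(0, 1)`**
whenever `Q((0, x₁), c) ⊆ Q(0, 1/2)`, with the pressure normalised to mean zero on `B(0, 1)` at
each time: a suitable weak solution in the unit ball with `esssup_t ∫_{B(0,1)} |v_c|² ≤ I₀`,
`∫_{Q(0,1)} |∇v_c|² ≤ I₀ < ∞` and pressure in `L^{3/2}(Q(0, 1))` (A–B §3, the estimate (3.3)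
for the rescaled sequence). [cite: AlbrittonBarker2019, §3] -/
theorem isSuitableWeakSolutionInBall_zoomInAt
    (hball : IsSuitableWeakSolutionInBall 1 0 v π)
    (hwg : HasWeakSpatialGradientOn (parabolicCylinderOpens 1 (0 : ℝ × EuclideanSpace ℝ (Fin 3))) v Gv)
    (hI : typeIBound (parabolicCylinder (1 / 2) (0 : ℝ × EuclideanSpace ℝ (Fin 3))) v π Gv ≠ ∞)
    (hc : 0 < c)
    (hsub : parabolicCylinder c (((0 : ℝ), x₁) : ℝ × EuclideanSpace ℝ (Fin 3)) ⊆
      parabolicCylinder (1 / 2) (0 : ℝ × EuclideanSpace ℝ (Fin 3))) :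
    IsSuitableWeakSolutionInBall 1 0 (c • stPull (c ^ 2) c 0 x₁ v)
      (fun t x => (c ^ 2 • stPull (c ^ 2) c 0 x₁ π) t x -
        ⨍ y in ball (0 : EuclideanSpace ℝ (Fin 3)) 1, (c ^ 2 • stPull (c ^ 2) c 0 x₁ π) t y) := by
  obtain ⟨h32, h32', h32r⟩ := threeHalves_facts
  obtain ⟨hsw, -, -, hπ⟩ := hball
  have hsub1 := parabolicCylinder_at_subset_one hsub
  set I := typeIBound (parabolicCylinder (1 / 2) (0 : ℝ × EuclideanSpace ℝ (Fin 3))) v π Gv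
    with hIdef
  have hsuit1 := zoomInAt_isSuitableWeakSolutionOn hsw hc hsub1
  have hwg1 := zoomInAt_hasWeakSpatialGradientOn hwg hc hsub1
  have hbound : abScaledSum 1 0 (c • stPull (c ^ 2) c 0 x₁ v) (c ^ 2 • stPull (c ^ 2) c 0 x₁ π)
      (c ^ 2 • stPull (c ^ 2) c 0 x₁ Gv) ≤ I :=
    abScaledSum_zoomInAt_le hc one_pos (parabolicCylinder_zoomInAt_one_subset c x₁ hsub)
  have hpm := memLp_zoomInAt_pressure hsw hπ hc hsub1
  have hmean := memLp_zoomInAt_pressure_mean hsw hπ hc hsub1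
  haveI : IsFiniteMeasure
      (volume.restrict (parabolicCylinder 1 (0 : ℝ × EuclideanSpace ℝ (Fin 3)))) :=
    ⟨by rw [Measure.restrict_apply_univ]; exact (volume_parabolicCylinder_ne_top 1 0).lt_top⟩
  refine ⟨?_, ?_, ⟨_, hwg1, ?_⟩, hpm.sub hmean⟩
  · refine hsuit1.sub_pressure (IntegrableOn.locallyIntegrableOn (hmean.integrable h32))
      fun K hK _ => ?_
    have hfin := hmean.eLpNorm_lt_top
    rw [eLpNorm_eq_lintegral_rpow_enorm_toReal (zero_lt_one.trans_le h32).ne' h32', h32r] at hfin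
    exact lt_of_le_of_lt (lintegral_mono_set hK)
      ((ENNReal.rpow_lt_top_iff_of_pos (by norm_num)).1 hfin)
  · refine ⟨I.toNNReal, ?_⟩
    have hA := cknAEss_le_abScaledSum.trans hbound
    unfold cknAEss at hA
    simp only [ENNReal.ofReal_one, inv_one, one_mul] at hA
    filter_upwards [ENNReal.ae_le_essSup fun t : ℝ =>
      ∫⁻ x in ball (0 : ℝ × EuclideanSpace ℝ (Fin 3)).2 1,
        ‖(c • stPull (c ^ 2) c 0 x₁ v) t x‖ₑ ^ 2]
      with t ht
    rw [ENNReal.coe_toNNReal hI]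
    exact ht.trans hA
  · have hE := cknE_le_abScaledSum.trans hbound
    unfold cknE at hE
    rw [ENNReal.ofReal_one, inv_one, one_mul] at hE
    exact lt_of_le_of_lt hE hI.lt_top

/-- **Uniform `L³` bound of the velocities zoomed about `(0, x₁)` on `Q(0, 1)`**
(`Q((0, x₁), c) ⊆ Q(0, 1/2)`): `‖v_c‖_{L³(Q(0,1))} ≤ I₀^{1/3}`
(`‖v_c‖³_{L³} = C(Q(0,1); v_c) ≤ I₀`; A–B (3.3)). [cite: AlbrittonBarker2019, §3] -/
theorem eLpNorm_zoomInAt_velocity_le (hc : 0 < c)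
    (hsub : parabolicCylinder c (((0 : ℝ), x₁) : ℝ × EuclideanSpace ℝ (Fin 3)) ⊆
      parabolicCylinder (1 / 2) (0 : ℝ × EuclideanSpace ℝ (Fin 3)))
    (π : ℝ → EuclideanSpace ℝ (Fin 3) → ℝ)
    (Gv : ℝ → EuclideanSpace ℝ (Fin 3) → EuclideanSpace ℝ (Fin 3) →L[ℝ] EuclideanSpace ℝ (Fin 3)) :
    eLpNorm (uncurry (c • stPull (c ^ 2) c 0 x₁ v)) 3
        (volume.restrict (parabolicCylinder 1 (0 : ℝ × EuclideanSpace ℝ (Fin 3)))) ≤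
      typeIBound (parabolicCylinder (1 / 2) (0 : ℝ × EuclideanSpace ℝ (Fin 3))) v π Gv ^
        (1 / 3 : ℝ) := by
  have hC : cknC 1 0 (c • stPull (c ^ 2) c 0 x₁ v) ≤
      typeIBound (parabolicCylinder (1 / 2) (0 : ℝ × EuclideanSpace ℝ (Fin 3))) v π Gv :=
    (cknC_le_abScaledSum (p := c ^ 2 • stPull (c ^ 2) c 0 x₁ π)
      (G := c ^ 2 • stPull (c ^ 2) c 0 x₁ Gv)).trans
      (abScaledSum_zoomInAt_le hc one_pos (parabolicCylinder_zoomInAt_one_subset c x₁ hsub))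
  unfold cknC at hC
  rw [ENNReal.ofReal_one, one_pow, inv_one, one_mul] at hC
  rw [eLpNorm_eq_lintegral_rpow_enorm_toReal (by norm_num) (by norm_num), ENNReal.toReal_ofNat]
  refine ENNReal.rpow_le_rpow ?_ (by norm_num)
  refine le_of_eq_of_le (lintegral_congr fun w => ?_) hC
  show ‖(c • stPull (c ^ 2) c 0 x₁ v) w.1 w.2‖ₑ ^ (3 : ℝ) =
    ‖(c • stPull (c ^ 2) c 0 x₁ v) w.1 w.2‖ₑ ^ (3 : ℕ)
  rw [← ENNReal.rpow_natCast]
  norm_num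

/-- **Uniform `L^{3/2}` bound of the normalised pressures zoomed about `(0, x₁)` on `Q(0, 1)`**
(`Q((0, x₁), c) ⊆ Q(0, 1/2)`): `‖π_c - [π_c]_{B(0,1)}‖_{L^{3/2}(Q(0,1))} ≤ I₀^{2/3}` (A–B (3.3)).
[cite: AlbrittonBarker2019, §3] -/
theorem eLpNorm_zoomInAt_pressure_le (hc : 0 < c)
    (hsub : parabolicCylinder c (((0 : ℝ), x₁) : ℝ × EuclideanSpace ℝ (Fin 3)) ⊆
      parabolicCylinder (1 / 2) (0 : ℝ × EuclideanSpace ℝ (Fin 3)))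
    (v : ℝ → EuclideanSpace ℝ (Fin 3) → EuclideanSpace ℝ (Fin 3))
    (Gv : ℝ → EuclideanSpace ℝ (Fin 3) → EuclideanSpace ℝ (Fin 3) →L[ℝ] EuclideanSpace ℝ (Fin 3)) :
    eLpNorm (uncurry fun t x => (c ^ 2 • stPull (c ^ 2) c 0 x₁ π) t x -
        ⨍ y in ball (0 : EuclideanSpace ℝ (Fin 3)) 1, (c ^ 2 • stPull (c ^ 2) c 0 x₁ π) t y)
        (3 / 2)
        (volume.restrict (parabolicCylinder 1 (0 : ℝ × EuclideanSpace ℝ (Fin 3)))) ≤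
      typeIBound (parabolicCylinder (1 / 2) (0 : ℝ × EuclideanSpace ℝ (Fin 3))) v π Gv ^
        (2 / 3 : ℝ) := by
  obtain ⟨h32, h32', h32r⟩ := threeHalves_facts
  have hD : cknDOsc 1 0 (c ^ 2 • stPull (c ^ 2) c 0 x₁ π) ≤
      typeIBound (parabolicCylinder (1 / 2) (0 : ℝ × EuclideanSpace ℝ (Fin 3))) v π Gv :=
    (cknDOsc_le_abScaledSum (u := c • stPull (c ^ 2) c 0 x₁ v)
      (G := c ^ 2 • stPull (c ^ 2) c 0 x₁ Gv)).trans
      (abScaledSum_zoomInAt_le hc one_pos (parabolicCylinder_zoomInAt_one_subset c x₁ hsub))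
  unfold cknDOsc at hD
  rw [ENNReal.ofReal_one, one_pow, inv_one, one_mul] at hD
  rw [eLpNorm_eq_lintegral_rpow_enorm_toReal (zero_lt_one.trans_le h32).ne' h32', h32r,
    show (1 / (3 / 2 : ℝ)) = 2 / 3 by norm_num]
  refine ENNReal.rpow_le_rpow ?_ (by norm_num)
  refine le_of_eq_of_le (lintegral_congr fun w => ?_) hD
  simp only [uncurry, Prod.snd_zero]

end ZoomInAt

/-! ### Persistence of the singularity with a `Tendsto … (𝓝 ∞)` hypothesis -/

section Persistence

/-- **Persistence of the singularity in the limit** (Rusin–Šverák 2011, Lemmas 2.1–2.2;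
Albritton–Barker 2019, Lemma 2.2 and Prop. 2.3 — the tree's `SuitableCompactness_holds` and
`PersistenceOfSingularities_holds`). Let `(W k, P k)` be suitable weak solutions in the unit parabolic
ball in the class of A–B Def. 2.1 with `sup_k ‖W k‖_{L³(Q(0,1))} + ‖P k‖_{L^{3/2}(Q(0,1))} < ∞`, whose
`L^∞(Q(0, R'))` norms tend to `∞` for every `0 < R' < 1`, and converging pointwise on `Q(0, 1/2)` to
a field `Wlim`. Then `Wlim` is unbounded near the space–time origin: for every `r > 0` and every `M`
there are `t ∈ (−r², 0)` and `x ∈ B(0, r)` with `M < ‖Wlim t x‖`. [cite: AlbrittonBarker2019, Lemma 2.2 and Prop. 2.3] -/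
theorem unbounded_at_origin_of_tendsto_top
    {W : ℕ → ℝ → EuclideanSpace ℝ (Fin 3) → EuclideanSpace ℝ (Fin 3)}
    {P : ℕ → ℝ → EuclideanSpace ℝ (Fin 3) → ℝ}
    (hInBall : ∀ k, IsSuitableWeakSolutionInBall 1 0 (W k) (P k))
    (hbound : (⨆ k, eLpNorm (uncurry (W k)) 3
        (volume.restrict (parabolicCylinder 1 (0 : ℝ × EuclideanSpace ℝ (Fin 3)))) +
      eLpNorm (uncurry (P k)) (3 / 2)
        (volume.restrict (parabolicCylinder 1 (0 : ℝ × EuclideanSpace ℝ (Fin 3))))) < ∞)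
    (hsing : ∀ R' ∈ Ioo (0 : ℝ) 1, Tendsto (fun k => eLpNorm (uncurry (W k)) ∞
        (volume.restrict (parabolicCylinder R' (0 : ℝ × EuclideanSpace ℝ (Fin 3))))) atTop (𝓝 ∞))
    {Wlim : ℝ → EuclideanSpace ℝ (Fin 3) → EuclideanSpace ℝ (Fin 3)}
    (hpt : ∀ z ∈ parabolicCylinder (1 / 2) (0 : ℝ × EuclideanSpace ℝ (Fin 3)),
      Tendsto (fun k => W k z.1 z.2) atTop (𝓝 (Wlim z.1 z.2))) :
    ∀ r > 0, ∀ M : ℝ, ∃ t ∈ Ioo (-(r ^ 2)) (0 : ℝ),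
      ∃ x ∈ ball (0 : EuclideanSpace ℝ (Fin 3)) r, M < ‖Wlim t x‖ := by
  -- ## Step 1: compactness (A–B Lemma 2.2) and persistence (A–B Prop. 2.3)
  obtain ⟨uinf, pinf, σ, hσ, hR⟩ := SuitableCompactness_holds W P hInBall hbound
  have hσt : Tendsto σ atTop atTop := hσ.tendsto_atTop
  have hboundσ : (⨆ j, eLpNorm (uncurry (W (σ j))) 3
        (volume.restrict (parabolicCylinder 1 (0 : ℝ × EuclideanSpace ℝ (Fin 3)))) +
      eLpNorm (uncurry (P (σ j))) (3 / 2)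
        (volume.restrict (parabolicCylinder 1 (0 : ℝ × EuclideanSpace ℝ (Fin 3))))) < ∞ := by
    refine lt_of_le_of_lt (iSup_le fun j => ?_) hbound
    exact le_iSup (fun k => eLpNorm (uncurry (W k)) 3
        (volume.restrict (parabolicCylinder 1 (0 : ℝ × EuclideanSpace ℝ (Fin 3)))) +
      eLpNorm (uncurry (P k)) (3 / 2)
        (volume.restrict (parabolicCylinder 1 (0 : ℝ × EuclideanSpace ℝ (Fin 3))))) (σ j)
  have hpers : IsBackwardSingularPoint uinf 0 :=
    PersistenceOfSingularities_holds (fun j => W (σ j)) (fun j => P (σ j)) uinf pinf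
      (fun j => hInBall (σ j)) hboundσ
      (fun R' hR' => ⟨(hR R' hR').1, (hR R' hR').2.2.1, (hR R' hR').2.2.2⟩)
      fun R' hR' => ((hsing R' hR').comp hσt).limsup_eq
  -- ## Step 2: identification `uinf = Wlim` a.e. on `Q(0, 1/2)`
  set μ : Measure (ℝ × EuclideanSpace ℝ (Fin 3)) :=
    volume.restrict (parabolicCylinder (1 / 2) (0 : ℝ × EuclideanSpace ℝ (Fin 3))) with hμ
  have hhalf : (1 / 2 : ℝ) ∈ Ioo (0 : ℝ) 1 := ⟨by norm_num, by norm_num⟩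
  obtain ⟨-, hmem, hL3, -⟩ := hR (1 / 2) hhalf
  have hsub1 : parabolicCylinder (1 / 2) (0 : ℝ × EuclideanSpace ℝ (Fin 3)) ⊆
      parabolicCylinder 1 (0 : ℝ × EuclideanSpace ℝ (Fin 3)) :=
    SuitableCompactness.parabolicCylinder_zero_mono (by norm_num) (by norm_num)
  have hmeasW : ∀ j, AEStronglyMeasurable (uncurry (W (σ j))) μ := fun j =>
    ((hInBall (σ j)).1.distributional.1.aestronglyMeasurable).mono_measure
      (Measure.restrict_mono hsub1 le_rfl)
  have hmeasU : AEStronglyMeasurable (uncurry uinf) μ := hmem.aestronglyMeasurable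
  have hinm : TendstoInMeasure μ (fun j => uncurry (W (σ j))) atTop (uncurry uinf) :=
    tendstoInMeasure_of_tendsto_eLpNorm (by norm_num) hmeasW hmeasU hL3
  obtain ⟨ns, hns, hae⟩ := hinm.exists_seq_tendsto_ae
  have hident : uncurry uinf =ᵐ[μ] uncurry Wlim := by
    have hmemQ : ∀ᵐ z ∂μ, z ∈ parabolicCylinder (1 / 2) (0 : ℝ × EuclideanSpace ℝ (Fin 3)) :=
      ae_restrict_mem (isOpen_parabolicCylinder _ _).measurableSet
    filter_upwards [hae, hmemQ] with z hz hzQ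
    have h2 : Tendsto (fun i => uncurry (W (σ (ns i))) z) atTop (𝓝 (uncurry Wlim z)) :=
      (hpt z hzQ).comp (hσt.comp hns.tendsto_atTop)
    exact tendsto_nhds_unique hz h2
  -- ## Step 3: essential unboundedness of `Wlim` near the origin
  intro r hr M
  by_contra hno
  push Not at hno
  set r' : ℝ := min r (1 / 2) with hr'
  have hr'pos : 0 < r' := lt_min hr (by norm_num)
  have hr'r : r' ≤ r := min_le_left _ _
  have hr'h : r' ≤ 1 / 2 := min_le_right _ _
  have hsub' : parabolicCylinder r' (0 : ℝ × EuclideanSpace ℝ (Fin 3)) ⊆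
      parabolicCylinder (1 / 2) (0 : ℝ × EuclideanSpace ℝ (Fin 3)) :=
    SuitableCompactness.parabolicCylinder_zero_mono hr'pos.le hr'h
  -- `Wlim` is bounded by `M` on `Q(0, r') ⊆ Q(0, r)`
  have hbd : eLpNorm (uncurry Wlim) ∞
      (volume.restrict (parabolicCylinder r' (0 : ℝ × EuclideanSpace ℝ (Fin 3)))) < ∞ := by
    rw [eLpNorm_exponent_top]
    refine eLpNormEssSup_lt_top_of_ae_bound (C := M) ?_
    refine (ae_restrict_mem (isOpen_parabolicCylinder _ _).measurableSet).mono ?_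
    rintro ⟨t, x⟩ hz
    rw [SuitableCompactness.mem_parabolicCylinder_zero] at hz
    have hr2 : r' ^ 2 ≤ r ^ 2 := pow_le_pow_left₀ hr'pos.le hr'r 2
    exact hno t ⟨by linarith [hz.1.1], hz.1.2⟩ x (mem_ball_zero_iff.2 (hz.2.trans_le hr'r))
  -- but `uinf = Wlim` a.e. there and `uinf` is singular at the origin
  have hcongr : eLpNorm (uncurry uinf) ∞
      (volume.restrict (parabolicCylinder r' (0 : ℝ × EuclideanSpace ℝ (Fin 3)))) =
      eLpNorm (uncurry Wlim) ∞
        (volume.restrict (parabolicCylinder r' (0 : ℝ × EuclideanSpace ℝ (Fin 3)))) :=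
    eLpNorm_congr_ae (ae_restrict_of_ae_restrict_of_subset hsub' hident)
  have htop := hpers r' hr'pos
  rw [hcongr] at htop
  exact hbd.ne htop

end Persistence

end Summit.NavierStokesRegularity.NavierStokesRegularity.Theorems

end
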